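import Summits.BirchSwinnertonDyer.BirchSwinnertonDyer.Theorems.GoldfeldAllTwistsTwoConverseTwinHalfTraceSevenModEightExportGalois
import Summits.BirchSwinnertonDyer.BirchSwinnertonDyer.Theorems.GoldfeldAllTwistsTwoConverseTwinQuarterTraceGenusTransport
import Summits.BirchSwinnertonDyer.BirchSwinnertonDyer.Theorems.GoldfeldAllTwistsTwoConverseTwinQuarterTracePartnerPAlphaModFourAlpha
import Summits.BirchSwinnertonDyer.BirchSwinnertonDyer.Theorems.GoldfeldAllTwistsTwoConverseTwinQuarterTracePartnerPHeightModFour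
import Summits.BirchSwinnertonDyer.BirchSwinnertonDyer.Theorems.GoldfeldAllTwistsTwoConverseTwinQuarterTraceSignaturesPAlphaModFourAlpha
import HarnessLib

set_option linter.dupNamespace false -- namespace `…BirchSwinnertonDyer.BirchSwinnertonDyer…` is the cell's (D-0017 nested layout)
set_option autoImplicit false

/-!
# ORDER (ccclxxxii) tranche T3 = Z⁺-0: `…QuarterTraceSignaturesPAlphaPlusModFourAlpha` — the type-α χ_p package over `K[1]` with its **`σ̃_q`-signature**

Cell `bsd-goldfeld`, seat `bsd-goldfeld-s1p-c3x` (gen 15). OBJECT A7⁺ = cells a71+ ∪ a75+ (type α, `q ≡ 7 (mod 8)`, `(q/7) = −1`; `p ≡ 1 (mod 4)`,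
`(−7/p) = +1`, `−7 ∉ 𝔽_p^{×4}`; `(p/q) = +1`), whose live genus lift is `σ̃_q` (`σ̃_qr_q = −r_q`, `σ̃_qr_p = r_p`) instead of `σ̃_p`.
VARIANT of C7A-P's `exists_chiP_package_alpha_L_modFourAlpha` (`…QuarterTraceSignaturesPAlphaModFourAlpha` §2; its §1
`exists_chiPAlpha_dataK_modFourAlpha` is IMPORTED, not restated): SAME binders (the χ_p package has NO `(p/q)` input), SAME data
`M_p, R_p, t_p` with `M_p • P_p = 4 • R_p + t_p`; the signature clause `∀ σ̃, σ̃r_q = r_q → σ̃r_p = −r_p → ∃ k odd, k•(σ̃R_p + R_p) = O` is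
REPLACED by **`∀ σ̃, σ̃r_q = −r_q → σ̃r_p = r_p → ∃ k odd, k•(σ̃R_p − R_p) = T`** (the paper's `s_p(σ̃_q) = [α] = 1`). MECHANISM: `σ̃_q` fixes
`r_p`, hence `s = κ/r_p` and the partner field `K₂ = ℚ(s) ≅ ℚ(√−2q)` pointwise, and negates `r_q`; its genus transport to `K₂[1]` is THEOREM A″'s
genus involution `g` (`gΨ′ = Ψ′ + P_χ`, `Y_q + gY_q = T`), so with `R_p = (mM′)Ψ′ + (mm′)Y_q` and `M′P_χ = (2m′)Y_q + t′`:
`σ̃_qR_p − R_p = m•t′ + (mm′)•T`, and `k₀•(…) = (k₀mm′)•T = T` (`k₀, m, m′` odd: type α). No complex conjugation is needed on this lift.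
`--supports stmt-BirchSwinnertonDyer-20044 --as helper`. Theses-free; theorems only; no definition, no new fact, no `sorry`. Binders BY NAME as in
the source. FRONTIER-grade: twist-density-ZERO sub-family modulo named print; never distance-to-summit. HONEST FRAMING: items 19140 / 20044 unchanged;
BSD is not proved by any of this.
-/


noncomputable section

open scoped Classical IntermediateField

open WeierstrassCurve Literature.NumberTheory.EllipticCurves Literature.NumberTheory.EllipticCurves.ModularForms
  Literature.NumberTheory.EllipticCurves.CaiShuTian2014 Literature.NumberTheory.EllipticCurves.CoatesLiTianZhai2015
  Literature.Computability.Cryptography.Hallgren2005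

namespace Summit.BirchSwinnertonDyer.BirchSwinnertonDyer.Theorems.GoldfeldGoodTwists

-- the cell's point-group world over `K[1]` / `K₂[1]` / `ℂ` (F2b's, P2e′'s); file-local
attribute [local instance 2000] Classical.propDecidable

section ChiPAlpha
variable {K : Type} [Field K] [NumberField K] (ι : K →+* ℂ) [FiniteDimensional K (ringClassField K ι 1)]
  [IsGalois K (ringClassField K ι 1)] [NumberField (ringClassField K ι 1)]

/-! ## The χ_p package over `K[1]` in type α, with the `σ̃_q`-signature -/

set_option maxHeartbeats 400000 in -- one long assembly (§1 + X3α-1 pulled back to `K[1]` + the genus transport X3b-1), as X3b-2b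
/-- **The type-α `χ_p` package in `X₀(49)(K[1])` with its `σ̃_q`-signature.** Setting and binders of F2b's `exists_chiP_package_alpha_modFourAlpha`
plus (F-η), (F-D), (F-norm) and the range property `hBL`. CONCLUSION: ODD `M_p`, points `R_p, t_p ∈ X₀(49)(K[1])` (`e_L R_p, e_L t_p ∈ B`,
`t_p` torsion) with `M_p • P_p = 4 • R_p + t_p`, and for every `σ̃ ∈ Gal(K[1]/K)` with `σ̃r_q = −r_q`, `σ̃r_p = r_p` an ODD `k` with
`k • (σ̃R_p − R_p) = T`. [cite: Gross1984, §§4–5] [cite: GrossLMS1991, Prop. 5.3] [cite: CoatesLiTianZhai2015, Thm. 4.4 and (2.8)]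
[cite: Cox2013, §6.A Thm. 6.1] -/
theorem exists_chiP_package_alpha_L_plusModFourAlpha (hEta₀ : x049_x_sub_two_eq_etaQuotient) (hD : deuring_etaQuotient49_heegner_generates_conjPrime)
    (hEta : x049_heegner_norm_x_sub_two_not_mem) (hCST : thm11_ringClassChar)
    (hGZ : ∀ (N : ℕ) [NeZero N] (W : WeierstrassCurve ℚ) (K : Type) [Field K] [NumberField K], gross_zagier N W K)
    (h12 : thm12_fullBSD_twist) (h44 : thm44_ord_two_LAlg) (h14 : thm14_rankOne_twist) (hS31 : bsdTriple_of_rank_le_one_of_conductor_lt)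
    (hnew : exists_isNewformOf) (hBT : burungaleTian_analyticRank_eq_zero_of_selmerCorank_eq_zero_of_hasCM)
    (hBF : bsdTriple_of_hasCM_of_L_one_ne_zero) (hGZK : rank_eq_analyticRank_of_analyticRank_le_one)
    (hK : IsImaginaryQuadratic K) {q p : ℕ} (hq : q.Prime) (hq8 : q % 8 = 7) (hq7 : jacobiSym q 7 = -1)
    [Fact p.Prime] (hp4 : p % 4 = 1) (hp7 : legendreSym p (-7) = 1) (hα : ¬ ∃ x : ZMod p, x ^ 4 = -7)
    (hdK : NumberField.discr K = -(8 * (q : ℤ) * p))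
    (hA : ∀ (K₂ : Type) [Field K₂] [NumberField K₂], IsImaginaryQuadratic K₂ → NumberField.discr K₂ = -(8 * (q : ℤ)) →
      ∀ P : (cm7.baseChange K₂).toAffine.Point, IsHeegnerPoint 49 cm7 K₂ P → ¬ IsOfFinAddOrder P)
    (har : ∀ (W : WeierstrassCurve ℚ) [W.IsElliptic] (C : VariableChange ℚ),
      C • W = cm7.quadraticTwist ((-2 * q : ℤ) : ℚ) → W.analyticRank = 1)
    (D₀ : ModularParametrizationData cm7 49) (hc : |D₀.c| = 1) (hw : cm7.rootNumber = 1)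
    (h0 : ∃ h, D₀.cuspZeroPoint = Affine.Point.some 2 (-1) h)
    {β : ℤ} (d : KolyvaginHeegnerData D₀ β ι 1) {rq rp : ringClassField K ι 1}
    (hrq : (rq : ℂ) ^ 2 = -(q : ℂ)) (hrp : (rp : ℂ) ^ 2 = (p : ℂ)) (B : AddSubgroup (cm7.baseChange ℂ).toAffine.Point) (S : Subfield ℂ)
    (hBfix : ∀ P : (cm7.baseChange (ringClassField K ι 1)).toAffine.Point,
      (∀ σ : ringClassField K ι 1 ≃ₐ[K] ringClassField K ι 1, σ rq = rq → σ rp = rp →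
        Affine.Point.map (σ : ringClassField K ι 1 →ₐ[K] ringClassField K ι 1) P = P) →
      Affine.Point.map (W' := cm7) (ringClassField K ι 1).subtype.toRatAlgHom P ∈ B)
    (hBS : ∀ (E : Type) [Field E] [CharZero E] (e : E →+* ℂ), e.fieldRange ≤ S →
      ∀ z : (cm7.baseChange E).toAffine.Point, Affine.Point.map (W' := cm7) e.toRatAlgHom z ∈ B)
    (hSK : ∀ k : K, ι k ∈ S) (hSq : (rq : ℂ) ∈ S) (hSp : (rp : ℂ) ∈ S)
    (hBL : ∀ z ∈ B, ∃ P : (cm7.baseChange (ringClassField K ι 1)).toAffine.Point,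
      Affine.Point.map (W' := cm7) (ringClassField K ι 1).subtype.toRatAlgHom P = z) :
    ∃ (Mp : ℤ) (Rp tp : (cm7.baseChange (ringClassField K ι 1)).toAffine.Point), Odd Mp ∧ IsOfFinAddOrder tp ∧
      Affine.Point.map (W' := cm7) (ringClassField K ι 1).subtype.toRatAlgHom Rp ∈ B ∧
      Affine.Point.map (W' := cm7) (ringClassField K ι 1).subtype.toRatAlgHom tp ∈ B ∧
      Mp • (∑ σ : ringClassField K ι 1 ≃ₐ[K] ringClassField K ι 1, (if σ rp = rp then (1 : ℤ) else -1) •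
            Affine.Point.map (σ : ringClassField K ι 1 →ₐ[K] ringClassField K ι 1) d.y) = (4 : ℤ) • Rp + tp ∧
      ∀ σ : ringClassField K ι 1 ≃ₐ[K] ringClassField K ι 1, σ rq = -rq → σ rp = rp →
        ∃ k : ℤ, Odd k ∧ k • (Affine.Point.map (σ : ringClassField K ι 1 →ₐ[K] ringClassField K ι 1) Rp - Rp) =
          Affine.Point.some 2 (-1) (nonsingular_cm7_baseChange_two_neg_one (ringClassField K ι 1)) := by
  haveI : (cm7.baseChange (ringClassField K ι 1)).IsElliptic := by rw [WeierstrassCurve.baseChange]; infer_instance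
  have hp : p.Prime := Fact.out
  obtain ⟨hq4, h3, hq2, -⟩ := mod_eight_eq_seven_arith hq8
  have hrpK := sq_eq_algebraMap_natCast' (ι := ι) hrp
  have hpL : (p : ringClassField K ι 1) ≠ 0 := by exact_mod_cast hp.ne_zero
  have hrp0 : rp ≠ 0 := by
    intro h; rw [h, zero_pow two_ne_zero, map_natCast] at hrpK
    exact hpL hrpK.symm
  have hrpC0 : (rp : ℂ) ≠ 0 := fun h ↦ hrp0 (Subtype.ext h)
  ------------------------------------------------------------------ §1's data; abbreviations `e_L`, `T`, `Y₂`, `ι₂`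
  obtain ⟨-, s, κ, H₂, P₂, tp, Mp, m, -, -, -, -, hs, hsr, hP₂, hMp, hm, htp, hrel, hY₂fix⟩ :=
    exists_chiPAlpha_dataK_modFourAlpha ι hCST hGZ h44 hnew hBT hBF hGZK hK hq hq8 hq7 hp4 hp7 hα hdK hA har D₀ hc hw h0 d hrq hrp
  set eL := Affine.Point.map (W' := cm7) (ringClassField K ι 1).subtype.toRatAlgHom with heL
  set TL : (cm7.baseChange (ringClassField K ι 1)).toAffine.Point := Affine.Point.some 2 (-1) (nonsingular_cm7_baseChange_two_neg_one (ringClassField K ι 1)) with hTL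
  have heLT : eL TL = Affine.Point.some 2 (-1) (nonsingular_cm7_baseChange_two_neg_one ℂ) := map_cm7_twoTorsion _
  set Y₂ : (cm7.baseChange (ringClassField K ι 1)).toAffine.Point := Affine.Point.map (ℚ⟮s⟯).val P₂ with hY₂def
  have hK₂ := isImaginaryQuadratic_adjoin_sqrt_neg_two_mul ι hq hs
  have hdK₂ := discr_adjoin_sqrt_neg_two_mul ι hq hq2 hs
  set ι₂ : (ℚ⟮s⟯ : IntermediateField ℚ (ringClassField K ι 1)) →+* ℂ := (ringClassField K ι 1).subtype.comp (algebraMap (ℚ⟮s⟯ : IntermediateField ℚ (ringClassField K ι 1)) (ringClassField K ι 1)) with hι₂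
  haveI := (finiteDimensional_and_isGalois_ringClassField hK₂ ι₂ one_ne_zero).1
  haveI := (finiteDimensional_and_isGalois_ringClassField hK₂ ι₂ one_ne_zero).2
  haveI : NumberField (ringClassField (ℚ⟮s⟯ : IntermediateField ℚ (ringClassField K ι 1)) ι₂ 1) := numberField_ringClassField hK₂ ι₂ one_ne_zero
  ------------------------------------------------------------------ X3α-1: THEOREM A″'s structure of `K₂` at `K₂[1]`, with Galois clauses
  obtain ⟨M', m', r₀, g, -, ΨF, PχF, YqF, t', hM', hm', ⟨k₀, hk₀, hk₀t⟩, -, hr₀C, hg, -, hP₂rel, hχrel, -, -, hΨfix, hYqfix,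
    hgΨ, hgY, hmem⟩ :=
    exists_sevenModEight_structure_galois hEta₀ hD hEta hCST hGZ h12 h44 h14 hS31 hnew hq hq8 hq7 hK₂ hdK₂ ι₂ D₀ hc H₂ P₂ hP₂ hrq
  -- `ℚ(s) ⊂ S` (`s = ι(κ)/r_p`): memberships of the structure points
  have hsS : (s : ℂ) ∈ S := by
    have e : (s : ℂ) * (rp : ℂ) = ι κ := by
      have h := congrArg (fun z : ringClassField K ι 1 ↦ (z : ℂ)) hsr
      simpa [coe_algebraMap_ringClassField] using h
    have e' : (s : ℂ) = ι κ * (rp : ℂ)⁻¹ := by rw [← e, mul_inv_cancel_right₀ hrpC0]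
    rw [e']
    exact S.mul_mem (hSK κ) (S.inv_mem hSp)
  have hQS : ∀ x : ℚ, ((algebraMap ℚ (ringClassField K ι 1) x : ringClassField K ι 1) : ℂ) ∈ S := fun x ↦ by
    rw [eq_ratCast, SubfieldClass.coe_ratCast]; exact SubfieldClass.ratCast_mem S x
  have hι₂S : ∀ x : (ℚ⟮s⟯ : IntermediateField ℚ (ringClassField K ι 1)), ι₂ x ∈ S := fun x ↦
    fieldRange_subtype_comp_algebraMap_adjoin_le (k := ℚ) s S hQS hsS (RingHom.mem_fieldRange.mpr ⟨x, rfl⟩)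
  obtain ⟨hΨB, hχB, hYqB, ht'B⟩ := hmem B S hSq hι₂S hBS
  -- `e_L Y₂ = 2 • e_F Ψ′ + e_F P_χ` (before `ι₂` is made opaque)
  have heY₂ : eL Y₂ = (2 : ℤ) • Affine.Point.map (W' := cm7) (ringClassField (ℚ⟮s⟯ : IntermediateField ℚ (ringClassField K ι 1)) ι₂ 1).subtype.toRatAlgHom ΨF +
      Affine.Point.map (W' := cm7) (ringClassField (ℚ⟮s⟯ : IntermediateField ℚ (ringClassField K ι 1)) ι₂ 1).subtype.toRatAlgHom PχF := by
    rw [← hP₂rel, ← hP₂, hY₂def, heL, Affine.Point.map_map]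
    cases P₂ <;> rfl
  have hιa : ∀ a : (ℚ⟮s⟯ : IntermediateField ℚ (ringClassField K ι 1)), ι₂ a = ((a : ringClassField K ι 1) : ℂ) := fun a ↦ rfl
  clear_value ι₂
  set eF := Affine.Point.map (W' := cm7) (ringClassField (ℚ⟮s⟯ : IntermediateField ℚ (ringClassField K ι 1)) ι₂ 1).subtype.toRatAlgHom with heF
  have hTF : eF (Affine.Point.some 2 (-1) (nonsingular_cm7_baseChange_two_neg_one (ringClassField (ℚ⟮s⟯ : IntermediateField ℚ (ringClassField K ι 1)) ι₂ 1))) = Affine.Point.some 2 (-1) (nonsingular_cm7_baseChange_two_neg_one ℂ) := map_cm7_twoTorsion _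
  have hinj : Function.Injective eL := fun a b h ↦
    Affine.Point.map_injective (W' := cm7) (f := (ringClassField K ι 1).subtype.toRatAlgHom) h
  ------------------------------------------------------------------ `K[1]`-preimages (range property `hBL`) and pulled-back relations
  obtain ⟨ΨLL, hΨLL⟩ := hBL _ hΨB
  obtain ⟨PχL, hPχL⟩ := hBL _ hχB
  obtain ⟨YqL, hYqL⟩ := hBL _ hYqB
  obtain ⟨t'L, ht'L⟩ := hBL _ ht'B
  have hY₂L : Y₂ = (2 : ℤ) • ΨLL + PχL := hinj (by simp only [map_add, map_zsmul, hΨLL, hPχL, heY₂])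
  have hχL : M' • PχL = (2 * m') • YqL + t'L := hinj (by
    have e := congrArg eF hχrel
    simp only [map_add, map_zsmul] at e
    simp only [map_add, map_zsmul, hPχL, hYqL, ht'L, e])
  have hk₀L : k₀ • t'L = 0 := hinj (by
    have e := congrArg eF hk₀t
    simp only [map_zsmul, map_zero] at e
    simp only [map_zsmul, map_zero, ht'L, e])
  have ht'Lt : IsOfFinAddOrder t'L := (isOfFinAddOrder_iff_zsmul_eq_zero).mpr ⟨k₀, fun h ↦ absurd (show Even k₀ from ⟨0, by rw [h, add_zero]⟩) (Int.not_even_iff_odd.mpr hk₀), hk₀L⟩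
  ------------------------------------------------------------------ the package: `M_p″ := M′M_p`, `R_p := (mM′)Ψ′ + (mm′)Y_q`, `t_p″ := (2m)t′ + M′t_p`
  obtain ⟨Rp, hRp⟩ : ∃ X : (cm7.baseChange (ringClassField K ι 1)).toAffine.Point, X = (m * M') • ΨLL + (m * m') • YqL := ⟨_, rfl⟩
  obtain ⟨tq, htq⟩ : ∃ X : (cm7.baseChange (ringClassField K ι 1)).toAffine.Point, X = (2 * m) • t'L + M' • tp := ⟨_, rfl⟩
  have hrel' : (M' * Mp) • (∑ σ : ringClassField K ι 1 ≃ₐ[K] ringClassField K ι 1, (if σ rp = rp then (1 : ℤ) else -1) •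
            Affine.Point.map (σ : ringClassField K ι 1 →ₐ[K] ringClassField K ι 1) d.y) = (4 : ℤ) • Rp + tq := by
    rw [mul_zsmul, hrel, hRp, htq, hY₂L]
    linear_combination (norm := module) (2 * m) • hχL
  have hY₂B : eL Y₂ ∈ B := hBfix Y₂ (fun σ _ h2 ↦ hY₂fix σ h2)
  have hPpB : eL (∑ σ : ringClassField K ι 1 ≃ₐ[K] ringClassField K ι 1, (if σ rp = rp then (1 : ℤ) else -1) •
            Affine.Point.map (σ : ringClassField K ι 1 →ₐ[K] ringClassField K ι 1) d.y) ∈ B :=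
    hBfix _ (fun σ _ h2 ↦ (isChiPoint_twistedSum (K := K) hrpK hrp0 d.y).1 σ h2)
  have htpB : eL tp ∈ B := by
    rw [eq_sub_of_add_eq' hrel.symm, map_sub, map_zsmul, map_zsmul]
    exact B.sub_mem (B.zsmul_mem hPpB _) (B.zsmul_mem hY₂B _)
  have hRpB : eL Rp ∈ B := by
    rw [hRp, map_add, map_zsmul, map_zsmul, hΨLL, hYqL]
    exact B.add_mem (B.zsmul_mem hΨB _) (B.zsmul_mem hYqB _)
  have htqB : eL tq ∈ B := by
    rw [htq, map_add, map_zsmul, map_zsmul, ht'L]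
    exact B.add_mem (B.zsmul_mem ht'B _) (B.zsmul_mem htpB _)
  have htq_t : IsOfFinAddOrder tq := by
    obtain ⟨a, ha, ha0⟩ := (isOfFinAddOrder_iff_zsmul_eq_zero).mp ht'Lt
    obtain ⟨b, hb, hb0⟩ := (isOfFinAddOrder_iff_zsmul_eq_zero).mp htp
    refine (isOfFinAddOrder_iff_zsmul_eq_zero).mpr ⟨a * b, mul_ne_zero ha hb, ?_⟩
    rw [htq, zsmul_add, smul_smul, smul_smul, show a * b * (2 * m) = (b * (2 * m)) * a by ring, show a * b * M' = (a * M') * b by ring,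
      mul_zsmul, ha0, zsmul_zero, mul_zsmul, hb0, zsmul_zero, add_zero]
  refine ⟨M' * Mp, Rp, tq, hM'.mul hMp, htq_t, hRpB, htqB, hrel', fun σ hσq hσp ↦ ⟨k₀, hk₀, ?_⟩⟩
  ------------------------------------------------------------------ the signature under `σ̃_q`: `ψ := σ̃_q` itself fixes `ℚ(s)` (since `σ̃_qr_p = r_p`) and negates `r_q`
  obtain ⟨ψ, hψ⟩ : ∃ ψ : ringClassField K ι 1 ≃ₐ[ℚ] ringClassField K ι 1, ψ = σ.restrictScalars ℚ := ⟨_, rfl⟩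
  have hψσ : ∀ X : (cm7.baseChange (ringClassField K ι 1)).toAffine.Point,
      Affine.Point.map (σ : ringClassField K ι 1 →ₐ[K] ringClassField K ι 1) X = Affine.Point.map (ψ : ringClassField K ι 1 →ₐ[ℚ] ringClassField K ι 1) X := fun X ↦ by
    have e' : (σ : ringClassField K ι 1 →ₐ[K] ringClassField K ι 1).restrictScalars ℚ = (ψ : ringClassField K ι 1 →ₐ[ℚ] ringClassField K ι 1) :=
      AlgHom.ext fun x ↦ by
        change σ x = ψ x
        rw [hψ, AlgEquiv.restrictScalars_apply]
    rw [← map_restrictScalars_eq (K := K) σ, e']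
  have hψs : ψ s = s := by
    rw [hψ, AlgEquiv.restrictScalars_apply]; exact (apply_sqrt_partner_of_mul_eq hsr hrp0 σ).1 hσp
  have hψrq : ψ rq = -rq := by
    rw [hψ, AlgEquiv.restrictScalars_apply, hσq]
  have hψF : ∀ a : (ℚ⟮s⟯ : IntermediateField ℚ (ringClassField K ι 1)), ψ (algebraMap _ (ringClassField K ι 1) a) = algebraMap _ (ringClassField K ι 1) a := fun a ↦ by
    rw [IntermediateField.algebraMap_apply]
    exact apply_eq_self_of_mem_adjoin_simple ψ hψs a.2
  ------------------------------------------------------------------ genus transport (X3b-1): `ψ` acts on `Ψ′`, `Y_q` as THEOREM A″'s genus involution `g`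
  have hcoe : ∀ a : (ℚ⟮s⟯ : IntermediateField ℚ (ringClassField K ι 1)), ((algebraMap _ (ringClassField (ℚ⟮s⟯ : IntermediateField ℚ (ringClassField K ι 1)) ι₂ 1) a : (ringClassField (ℚ⟮s⟯ : IntermediateField ℚ (ringClassField K ι 1)) ι₂ 1)) : ℂ) = ((algebraMap _ (ringClassField K ι 1) a : ringClassField K ι 1) : ℂ) :=
    fun a ↦ by rw [coe_algebraMap_ringClassField, IntermediateField.algebraMap_apply]; exact hιa a
  have hr : (rq : ℂ) = (r₀ : ℂ) := hr₀C.symm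
  have hψg : ((ψ rq : ringClassField K ι 1) : ℂ) = ((g r₀ : (ringClassField (ℚ⟮s⟯ : IntermediateField ℚ (ringClassField K ι 1)) ι₂ 1)) : ℂ) := by
    rw [hψrq, hg]; push_cast; rw [hr]
  have hTΨ : eL (Affine.Point.map (ψ : ringClassField K ι 1 →ₐ[ℚ] ringClassField K ι 1) ΨLL) =
      eF (Affine.Point.map (g : (ringClassField (ℚ⟮s⟯ : IntermediateField ℚ (ringClassField K ι 1)) ι₂ 1) →ₐ[ℚ⟮s⟯] (ringClassField (ℚ⟮s⟯ : IntermediateField ℚ (ringClassField K ι 1)) ι₂ 1)) ΨF) :=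
    map_subtype_map_eq_of_genusTransport ι _ (ringClassField (ℚ⟮s⟯ : IntermediateField ℚ (ringClassField K ι 1)) ι₂ 1) hcoe r₀ rq hr ψ hψF g hψg ΨF hΨfix ΨLL hΨLL
  have hTY : eL (Affine.Point.map (ψ : ringClassField K ι 1 →ₐ[ℚ] ringClassField K ι 1) YqL) =
      eF (Affine.Point.map (g : (ringClassField (ℚ⟮s⟯ : IntermediateField ℚ (ringClassField K ι 1)) ι₂ 1) →ₐ[ℚ⟮s⟯] (ringClassField (ℚ⟮s⟯ : IntermediateField ℚ (ringClassField K ι 1)) ι₂ 1)) YqF) :=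
    map_subtype_map_eq_of_genusTransport ι _ (ringClassField (ℚ⟮s⟯ : IntermediateField ℚ (ringClassField K ι 1)) ι₂ 1) hcoe r₀ rq hr ψ hψF g hψg YqF hYqfix YqL hYqL
  have hgY' : Affine.Point.map (g : (ringClassField (ℚ⟮s⟯ : IntermediateField ℚ (ringClassField K ι 1)) ι₂ 1) →ₐ[ℚ⟮s⟯] (ringClassField (ℚ⟮s⟯ : IntermediateField ℚ (ringClassField K ι 1)) ι₂ 1)) YqF = Affine.Point.some 2 (-1) (nonsingular_cm7_baseChange_two_neg_one (ringClassField (ℚ⟮s⟯ : IntermediateField ℚ (ringClassField K ι 1)) ι₂ 1)) - YqF := eq_sub_of_add_eq' hgY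
  have hψΨ : Affine.Point.map (ψ : ringClassField K ι 1 →ₐ[ℚ] ringClassField K ι 1) ΨLL = ΨLL + PχL := hinj (by
    rw [hTΨ, hgΨ]; simp only [map_add, hΨLL, hPχL])
  have hψY : Affine.Point.map (ψ : ringClassField K ι 1 →ₐ[ℚ] ringClassField K ι 1) YqL = TL - YqL := hinj (by
    rw [hTY, hgY']; simp only [map_sub, hTF, hYqL, heLT])
  have hψT : Affine.Point.map (ψ : ringClassField K ι 1 →ₐ[ℚ] ringClassField K ι 1) TL = TL := by
    rw [hTL, Affine.Point.map_some]; congr 1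
    · exact map_ofNat _ 2
    · simp only [map_neg, map_one]
  have hT2 : 2 • TL = 0 := by rw [two_nsmul]; exact cm7_twoTorsion_add_self _
  ------------------------------------------------------------------ `σ̃_qR_p − R_p = m•t′ + (mm′)•T`: `t′` is killed by the odd `k₀`, `(k₀mm′)•T = T`
  have hfinal : Affine.Point.map (σ : ringClassField K ι 1 →ₐ[K] ringClassField K ι 1) Rp - Rp = m • t'L + (m * m') • TL := by
    rw [hRp, map_add, map_zsmul, map_zsmul, hψσ, hψσ, hψΨ, hψY, eq_sub_of_add_eq' hχL.symm]
    module
  rw [hfinal, zsmul_add, smul_comm k₀ m t'L, hk₀L, zsmul_zero, zero_add, smul_smul]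
  exact zsmul_twoTorsion_of_odd hT2 (hk₀.mul (hm.mul hm'))

end ChiPAlpha

end Summit.BirchSwinnertonDyer.BirchSwinnertonDyer.Theorems.GoldfeldGoodTwists

end
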